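import Summits.CriticalPhenomena.PercolationContinuityZ3.Theorems.PercNearOneGluingNoHeavyLowerTailSectorTransfer
import HarnessLib

/-!
# `NoHeavyLowerTail` (stmt-CriticalPhenomena-4575) — three relays: the OBSERVER-EXCHANGE reduction of KN Question 7,
# part 1 (tools)  (depth prover `nh-dp-commonrelay`, gen 7)

Support file (`--supports stmt-CriticalPhenomena-4575`); no definitions, no named facts, no sorries.
Setting of Kozma–Nitzan's Theorem 2 (arXiv:2401.12397, pp. 8–9): relays `a₁, a₂, a₃` (designated `a₃`, `τ₃ ≤ τ₁, τ₂`),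
observer `o`, target `b`; `N₁ = {a₁ ↮ a₂, a₃}`, `N₂ = {a₂ ↮ a₁, a₃}`, `N₁₂ = {a₃ ↮ a₁, a₂}`, `W₃ = N₁₂ ∩ {a₁ ↔ a₂}`,
`P_j = μ(N_j)`, `A_j = μ(N_j ∩ {a_j ↔ o})` (`φ_j = A_j / P_j`), `τ_j = μ(a_j ↔ b)`,
`A₃ := μ(W₃, b ↔ a₁, a₂) − μ(W₃, b ↔ a₃)` (`≥ 0` under `τ₃ ≤ τ₁`, KN Lemma 3(i)), and the exchange functional
`L₁(Q) := μ(Q, a₁ ↔ b) − μ(Q, a₃ ↔ b)`.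

MAIN RESULT (in the sibling file `…ObserverExchange.lean`, `preFKG3_of_observerExchange`): pre-FKG (3) at `a₃` (KN Question 7 for three relays) follows from the SINGLE
inequality
  `[K]  P₂ A₁ (τ₁ − τ₃) + P₁ A₂ A₃ ≤ P₁ P₂ · L₁({o ↔ a₁})`,  i.e.  `μ(o↔a₁↔b) − μ(o↔a₁, a₃↔b) ≥ φ₁ (τ₁ − τ₃) + φ₂ A₃`
(registered stub `stub_observerExchangeThreeRelays`, both minimiser hypotheses kept).  Mechanism (memo RESIDUAL-gen7.md in
run/shared/lean/prim/prim-nh-dp-commonrelay/): with `TOT3 := X − φ₁(τ₁−τ₃) − φ₂(τ₂−τ₃)` (`X = μ(o↔A,o↔b) − μ(o↔A,a₃↔b)`) one has the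
exact identity `TOT3 = [K]/(P₁P₂) + cov₂ / P₂` where `cov₂ := P₂ (T₂ − V₂) − A₂ (μ(N₂, a₂↔b) − μ(N₂, a₃↔b)) ≥ 0` is a van den
Berg–Häggström–Kahn covariance on `N₂` (Thm. 1.3 for `{a₂↔o},{a₂↔b}` ⊂ C(a₂)` and Thm. 1.4 for `{a₂↔o}` vs `{a₃↔b} ⊂ C({a₁,a₃})`),
PROVED here (`obs_cov2`).  So the whole 3-relay rung reduces to `[K]`, which is `TW3 + cov₁` with `TW3 := α' − (φ₁+φ₂)A₃` the
glued-world row of the memo (the ONE-SIDED forms of `TW3`, of sector (I) and of sector (II) are all false: `…SectorClaimIOneSidedCex`,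
`…SectorOneSidedCex`; `[K]` has 0 violations in all censuses so far, see the memo).
Contents of THIS file: `obs_bhkCross` (BHK 1.4 with a single-vertex connection read inside the cluster of a set), `obs_cov2`, and the
bookkeeping identities `obs_V2_split`, `obs_t3N2_split`, `obs_m3_split`, `obs_t2_sub`, `obs_L1_split` (with their set lemmas).  The arithmetic and
the assembly are in `…ObserverExchange.lean`.
[cite: KozmaNitzan2024, Theorem 2 (§3.1, pp. 8–9), Lemma 3 (pp. 6–7), Question 7 (§5.5, p. 36); VandenbergHaggstromKahn2005, Thms. 1.3–1.4]
-/

namespace Summit.CriticalPhenomena.PercolationContinuityZ3.Theorems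

open MeasureTheory Set Literature.Probability.LatticeModels Literature.Probability.Percolation

noncomputable section
open Classical

variable {n : ℕ}

/-! ### BHK Thm 1.4 with a single-vertex connection inside the cluster of a set -/

/-- At `C = C_{S'}(ω)` and `x ∈ S'`, the indicator of `{C | ∃ s ∈ {x}, s ↔ y in C}` is `1{x ↔ y}(ω)`. [folklore] -/
theorem obs_anyReach_apply_sub (S' : Finset (Fin n)) {x : Fin n} (hx : x ∈ S') (y : Fin n) (ω : BondConfig (Fin n)) :
    {C : Set (Sym2 (Fin n)) | ∃ s ∈ ({x} : Finset (Fin n)), (openGraph C).Reachable s y}.indicator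
        (1 : Set (Sym2 (Fin n)) → ℝ) (⋃ s' ∈ S', openEdgeCluster ω s') =
      (openConn x y : Set (BondConfig (Fin n))).indicator 1 ω := by
  by_cases h : (openGraph ω).Reachable x y
  · have h1 : (⋃ s' ∈ S', openEdgeCluster ω s') ∈
        {C : Set (Sym2 (Fin n)) | ∃ s ∈ ({x} : Finset (Fin n)), (openGraph C).Reachable s y} :=
      ⟨x, Finset.mem_singleton_self x, (knThm2_reachable_biUnion_iff S' hx y ω).2 h⟩
    have h2 : ω ∈ (openConn x y : Set (BondConfig (Fin n))) := h
    rw [Set.indicator_of_mem h1, Set.indicator_of_mem h2, Pi.one_apply, Pi.one_apply]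
  · have h1 : (⋃ s' ∈ S', openEdgeCluster ω s') ∉
        {C : Set (Sym2 (Fin n)) | ∃ s ∈ ({x} : Finset (Fin n)), (openGraph C).Reachable s y} := by
      rintro ⟨s, hs, hr⟩
      rw [Finset.mem_singleton] at hs
      subst hs
      exact h ((knThm2_reachable_biUnion_iff S' hx y ω).1 hr)
    have h2 : ω ∉ (openConn x y : Set (BondConfig (Fin n))) := h
    rw [Set.indicator_of_notMem h1, Set.indicator_of_notMem h2]

/-- **BHK 2006 Thm. 1.4 (from the registered `stub_bhkSets`), cross form with a single-vertex connection:** for disjoint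
`S, S'` and `x ∈ S'`, `μ(D') μ(D' ∩ {S ↔ o} ∩ {x ↔ y}) ≤ μ(D' ∩ {S ↔ o}) μ(D' ∩ {x ↔ y})`, `D' = {S ↮ S'}`
(`1{x ↔ y}` is an increasing function of the edge cluster of `S'`). [cite: VandenbergHaggstromKahn2005, Thm. 1.4 (p. 7)] -/
theorem obs_bhkCross (w : Sym2 (Fin n) → unitInterval) (S S' : Finset (Fin n)) (o : Fin n) {x : Fin n} (hx : x ∈ S')
    (y : Fin n) (hSS' : Disjoint S S') :
    (prodBernoulli w).real
          {ω : BondConfig (Fin n) | ∀ s ∈ S, ∀ x ∈ S', ¬ (openGraph ω).Reachable s x} *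
        (prodBernoulli w).real
          ({ω : BondConfig (Fin n) | ∀ s ∈ S, ∀ x ∈ S', ¬ (openGraph ω).Reachable s x} ∩
            ((⋃ s ∈ S, openConn s o) ∩ openConn x y)) ≤
      (prodBernoulli w).real
          ({ω : BondConfig (Fin n) | ∀ s ∈ S, ∀ x ∈ S', ¬ (openGraph ω).Reachable s x} ∩
            ⋃ s ∈ S, openConn s o) *
        (prodBernoulli w).real
          ({ω : BondConfig (Fin n) | ∀ s ∈ S, ∀ x ∈ S', ¬ (openGraph ω).Reachable s x} ∩ openConn x y) := by
  have key := stub_bhkSets.2 n w S S'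
    ({C : Set (Sym2 (Fin n)) | ∃ s ∈ S, (openGraph C).Reachable s o}.indicator 1)
    ({C : Set (Sym2 (Fin n)) | ∃ s ∈ ({x} : Finset (Fin n)), (openGraph C).Reachable s y}.indicator 1)
    (knThm2_monotone_anyReach S o) (knThm2_monotone_anyReach {x} y) hSS'
  simp only [knThm2_anyReach_apply, obs_anyReach_apply_sub S' hx] at key
  have h := knThm2_setIntegral_indicator w
    {ω : BondConfig (Fin n) | ∀ s ∈ S, ∀ x ∈ S', ¬ (openGraph ω).Reachable s x}
    (⋃ s ∈ S, openConn s o) (openConn x y)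
  have h' := knThm2_setIntegral_indicator w
    {ω : BondConfig (Fin n) | ∀ s ∈ S, ∀ x ∈ S', ¬ (openGraph ω).Reachable s x}
    (openConn x y) (openConn x y)
  rw [h.1, h'.1, h.2] at key
  exact key

/-! ### The free N₂-world covariance `cov₂ ≥ 0` -/

/-- **`cov₂ ≥ 0` (PROVED), division-free:**
`A₂ · (μ(N₂ ∩ {a₂↔b}) − μ(N₂ ∩ {a₃↔b})) ≤ P₂ · (μ(N₂ ∩ {a₂↔o} ∩ {a₂↔b}) − μ(N₂ ∩ {a₂↔o} ∩ {a₃↔b}))`: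
on `N₂ = {a₂ ↮ a₁, a₃}` the observer's attachment `{a₂↔o}` is positively correlated with `{a₂↔b}` (BHK Thm. 1.3) and
negatively with `{a₃↔b}` (BHK Thm. 1.4, clusters of `{a₂}` and `{a₁,a₃}`).
[cite: VandenbergHaggstromKahn2005, Thms. 1.3–1.4; KozmaNitzan2024, Lemma 1 (pp. 5–6)] -/
theorem obs_cov2 (w : Sym2 (Fin n) → unitInterval) (o b a₁ a₂ a₃ : Fin n) (h12 : a₁ ≠ a₂) (h23 : a₂ ≠ a₃) :
    (prodBernoulli w).real ((openConn a₂ a₁)ᶜ ∩ (openConn a₂ a₃)ᶜ ∩ openConn a₂ o) *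
        ((prodBernoulli w).real ((openConn a₂ a₁)ᶜ ∩ (openConn a₂ a₃)ᶜ ∩ openConn a₂ b) -
          (prodBernoulli w).real ((openConn a₂ a₁)ᶜ ∩ (openConn a₂ a₃)ᶜ ∩ openConn a₃ b)) ≤
      (prodBernoulli w).real ((openConn a₂ a₁)ᶜ ∩ (openConn a₂ a₃)ᶜ : Set (BondConfig (Fin n))) *
        ((prodBernoulli w).real ((openConn a₂ a₁)ᶜ ∩ (openConn a₂ a₃)ᶜ ∩ (openConn a₂ o ∩ openConn a₂ b)) -
          (prodBernoulli w).real ((openConn a₂ a₁)ᶜ ∩ (openConn a₂ a₃)ᶜ ∩ (openConn a₂ o ∩ openConn a₃ b))) := by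
  have hX : ∀ s ∈ ({a₂} : Finset (Fin n)), s ∉ ({a₁, a₃} : Set (Fin n)) := by
    intro s hs
    rw [Finset.mem_singleton] at hs
    subst hs
    simp only [Set.mem_insert_iff, Set.mem_singleton_iff, not_or]
    exact ⟨fun h => h12 h.symm, h23⟩
  have i1 := knThm2_bhkOne stub_bhkSets.1 w {a₂} ({a₁, a₃} : Set (Fin n)) o b hX
  rw [knThm2_sep_single_set, Finset.set_biUnion_singleton, Finset.set_biInter_singleton] at i1
  have hdis : Disjoint ({a₂} : Finset (Fin n)) {a₁, a₃} := by
    simp only [Finset.disjoint_singleton_left, Finset.mem_insert, Finset.mem_singleton, not_or]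
    exact ⟨fun h => h12 h.symm, h23⟩
  have i2 := obs_bhkCross w {a₂} {a₁, a₃} o (x := a₃) (by simp) b hdis
  rw [knThm2_sep_single_finset, Finset.set_biUnion_singleton] at i2
  nlinarith [i1, i2]

/-! ### Bookkeeping identities -/

/-- On `N₂ ∩ {a₃↔b}`, `a₁ ↔ a₃` iff `a₁ ↔ b`: the part of `N₂ ∩ {a₂↔o} ∩ {a₃↔b}` with `a₁ ↔ a₃`. [folklore] -/
theorem obs_setV2_in (o b a₁ a₂ a₃ : Fin n) :
    ((openConn a₂ a₁)ᶜ ∩ (openConn a₂ a₃)ᶜ ∩ (openConn a₂ o ∩ openConn a₃ b) ∩ openConn a₁ a₃ : Set (BondConfig (Fin n))) =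
      (openConn a₂ a₁)ᶜ ∩ (openConn a₂ a₃)ᶜ ∩ (openConn a₂ o ∩ (openConn a₁ b ∩ openConn a₃ b)) := by
  ext ω
  simp only [Set.mem_inter_iff, Set.mem_compl_iff, knThm2_mem_openConn]
  constructor
  · rintro ⟨⟨hN, h2o, h3b⟩, h13⟩
    exact ⟨hN, h2o, h13.trans h3b, h3b⟩
  · rintro ⟨hN, h2o, h1b, h3b⟩
    exact ⟨⟨hN, h2o, h3b⟩, h1b.trans h3b.symm⟩

/-- The part of `N₂ ∩ {a₂↔o} ∩ {a₃↔b}` with `a₁ ↮ a₃` is `M ∩ {a₂↔o} ∩ {a₃↔b}`. [folklore] -/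
theorem obs_setV2_out (o b a₁ a₂ a₃ : Fin n) :
    (((openConn a₂ a₁)ᶜ ∩ (openConn a₂ a₃)ᶜ ∩ (openConn a₂ o ∩ openConn a₃ b)) \ openConn a₁ a₃ : Set (BondConfig (Fin n))) =
      (openConn a₂ a₁)ᶜ ∩ (openConn a₂ a₃)ᶜ ∩ (openConn a₁ a₃)ᶜ ∩ (openConn a₂ o ∩ openConn a₃ b) := by
  ext ω
  simp only [Set.mem_sdiff, Set.mem_inter_iff, Set.mem_compl_iff]
  tauto

/-- `V₂ = U₂ + I₂`: `μ(N₂ ∩ {a₂↔o} ∩ {a₃↔b}) = μ(N₂ ∩ {a₂↔o} ∩ {a₁↔b} ∩ {a₃↔b}) + μ(M ∩ {a₂↔o} ∩ {a₃↔b})`. [folklore] -/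
theorem obs_V2_split (w : Sym2 (Fin n) → unitInterval) (o b a₁ a₂ a₃ : Fin n) :
    (prodBernoulli w).real ((openConn a₂ a₁)ᶜ ∩ (openConn a₂ a₃)ᶜ ∩ (openConn a₂ o ∩ openConn a₃ b)) =
      (prodBernoulli w).real ((openConn a₂ a₁)ᶜ ∩ (openConn a₂ a₃)ᶜ ∩ (openConn a₂ o ∩ (openConn a₁ b ∩ openConn a₃ b))) +
        (prodBernoulli w).real ((openConn a₂ a₁)ᶜ ∩ (openConn a₂ a₃)ᶜ ∩ (openConn a₁ a₃)ᶜ ∩ (openConn a₂ o ∩ openConn a₃ b)) := by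
  have h := measureReal_inter_add_sdiff (μ := prodBernoulli w)
    (s := ((openConn a₂ a₁)ᶜ ∩ (openConn a₂ a₃)ᶜ ∩ (openConn a₂ o ∩ openConn a₃ b) : Set (BondConfig (Fin n))))
    (t := openConn a₁ a₃) MeasurableSet.of_discrete
  rw [obs_setV2_in, obs_setV2_out] at h
  exact h.symm

/-- On `N₂ ∩ {a₃↔b}`, the part with `a₁ ↔ a₃` is `N₂ ∩ {a₁↔b} ∩ {a₃↔b}`. [folklore] -/
theorem obs_sett3_in (b a₁ a₂ a₃ : Fin n) :
    ((openConn a₂ a₁)ᶜ ∩ (openConn a₂ a₃)ᶜ ∩ openConn a₃ b ∩ openConn a₁ a₃ : Set (BondConfig (Fin n))) =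
      (openConn a₂ a₁)ᶜ ∩ (openConn a₂ a₃)ᶜ ∩ (openConn a₁ b ∩ openConn a₃ b) := by
  ext ω
  simp only [Set.mem_inter_iff, Set.mem_compl_iff, knThm2_mem_openConn]
  constructor
  · rintro ⟨⟨hN, h3b⟩, h13⟩
    exact ⟨hN, h13.trans h3b, h3b⟩
  · rintro ⟨hN, h1b, h3b⟩
    exact ⟨⟨hN, h3b⟩, h1b.trans h3b.symm⟩

/-- The part of `N₂ ∩ {a₃↔b}` with `a₁ ↮ a₃` is `M ∩ {a₃↔b}`. [folklore] -/
theorem obs_sett3_out (b a₁ a₂ a₃ : Fin n) :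
    (((openConn a₂ a₁)ᶜ ∩ (openConn a₂ a₃)ᶜ ∩ openConn a₃ b) \ openConn a₁ a₃ : Set (BondConfig (Fin n))) =
      (openConn a₂ a₁)ᶜ ∩ (openConn a₂ a₃)ᶜ ∩ (openConn a₁ a₃)ᶜ ∩ openConn a₃ b := by
  ext ω
  simp only [Set.mem_sdiff, Set.mem_inter_iff, Set.mem_compl_iff]
  tauto

/-- `μ(N₂ ∩ {a₃↔b}) = μ(N₂ ∩ {a₁↔b} ∩ {a₃↔b}) + μ(M ∩ {a₃↔b})`. [folklore] -/
theorem obs_t3N2_split (w : Sym2 (Fin n) → unitInterval) (b a₁ a₂ a₃ : Fin n) :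
    (prodBernoulli w).real ((openConn a₂ a₁)ᶜ ∩ (openConn a₂ a₃)ᶜ ∩ openConn a₃ b) =
      (prodBernoulli w).real ((openConn a₂ a₁)ᶜ ∩ (openConn a₂ a₃)ᶜ ∩ (openConn a₁ b ∩ openConn a₃ b)) +
        (prodBernoulli w).real ((openConn a₂ a₁)ᶜ ∩ (openConn a₂ a₃)ᶜ ∩ (openConn a₁ a₃)ᶜ ∩ openConn a₃ b) := by
  have h := measureReal_inter_add_sdiff (μ := prodBernoulli w)
    (s := ((openConn a₂ a₁)ᶜ ∩ (openConn a₂ a₃)ᶜ ∩ openConn a₃ b : Set (BondConfig (Fin n))))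
    (t := openConn a₁ a₃) MeasurableSet.of_discrete
  rw [obs_sett3_in, obs_sett3_out] at h
  exact h.symm

/-- The part of `N₁₂ ∩ {a₃↔b}` with `a₁ ↔ a₂` (the glued world `W₃`). [folklore] -/
theorem obs_setm3_in (b a₁ a₂ a₃ : Fin n) :
    ((openConn a₁ a₃)ᶜ ∩ (openConn a₂ a₃)ᶜ ∩ openConn a₃ b ∩ openConn a₁ a₂ : Set (BondConfig (Fin n))) =
      (openConn a₁ a₃)ᶜ ∩ (openConn a₂ a₃)ᶜ ∩ (openConn a₁ a₂ ∩ openConn a₃ b) := by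
  ext ω
  simp only [Set.mem_inter_iff, Set.mem_compl_iff]
  tauto

/-- The part of `N₁₂ ∩ {a₃↔b}` with `a₁ ↮ a₂` is `M ∩ {a₃↔b}` (in the `N₂`-based spelling of `M`). [folklore] -/
theorem obs_setm3_out (b a₁ a₂ a₃ : Fin n) :
    (((openConn a₁ a₃)ᶜ ∩ (openConn a₂ a₃)ᶜ ∩ openConn a₃ b) \ openConn a₁ a₂ : Set (BondConfig (Fin n))) =
      (openConn a₂ a₁)ᶜ ∩ (openConn a₂ a₃)ᶜ ∩ (openConn a₁ a₃)ᶜ ∩ openConn a₃ b := by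
  ext ω
  simp only [Set.mem_sdiff, Set.mem_inter_iff, Set.mem_compl_iff, knThm2_mem_openConn]
  constructor
  · rintro ⟨⟨⟨h13, h23⟩, h3b⟩, h12⟩
    exact ⟨⟨⟨fun h => h12 h.symm, h23⟩, h13⟩, h3b⟩
  · rintro ⟨⟨⟨h21, h23⟩, h13⟩, h3b⟩
    exact ⟨⟨⟨h13, h23⟩, h3b⟩, fun h => h21 h.symm⟩

/-- `m₃ = m₃^{W₃} + m₃^M`: `μ(N₁₂ ∩ {a₃↔b}) = μ(N₁₂ ∩ {a₁↔a₂} ∩ {a₃↔b}) + μ(M ∩ {a₃↔b})`. [folklore] -/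
theorem obs_m3_split (w : Sym2 (Fin n) → unitInterval) (b a₁ a₂ a₃ : Fin n) :
    (prodBernoulli w).real ((openConn a₁ a₃)ᶜ ∩ (openConn a₂ a₃)ᶜ ∩ openConn a₃ b) =
      (prodBernoulli w).real ((openConn a₁ a₃)ᶜ ∩ (openConn a₂ a₃)ᶜ ∩ (openConn a₁ a₂ ∩ openConn a₃ b)) +
        (prodBernoulli w).real ((openConn a₂ a₁)ᶜ ∩ (openConn a₂ a₃)ᶜ ∩ (openConn a₁ a₃)ᶜ ∩ openConn a₃ b) := by
  have h := measureReal_inter_add_sdiff (μ := prodBernoulli w)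
    (s := ((openConn a₁ a₃)ᶜ ∩ (openConn a₂ a₃)ᶜ ∩ openConn a₃ b : Set (BondConfig (Fin n))))
    (t := openConn a₁ a₂) MeasurableSet.of_discrete
  rw [obs_setm3_in, obs_setm3_out] at h
  exact h.symm

/-- **`τ₂ − τ₃ − A₃ = μ(N₂ ∩ {a₂↔b}) − μ(N₂ ∩ {a₃↔b})`**: the reliability gap of the pair `(a₂, a₃)` splits into its
`N₂`-world part and the glued-world exchange slack `A₃ = μ(W₃, b↔a₁,a₂) − μ(W₃, b↔a₃)`.
[cite: KozmaNitzan2024, Theorem 3, eq. (11) (p. 10)] -/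
theorem obs_t2_sub (w : Sym2 (Fin n) → unitInterval) (b a₁ a₂ a₃ : Fin n) :
    (prodBernoulli w).real (openConn a₂ b) - (prodBernoulli w).real (openConn a₃ b) -
        ((prodBernoulli w).real ((openConn a₁ a₃)ᶜ ∩ (openConn a₂ a₃)ᶜ ∩ (openConn a₁ b ∩ openConn a₂ b)) -
          (prodBernoulli w).real ((openConn a₁ a₃)ᶜ ∩ (openConn a₂ a₃)ᶜ ∩ (openConn a₁ a₂ ∩ openConn a₃ b))) =
      (prodBernoulli w).real ((openConn a₂ a₁)ᶜ ∩ (openConn a₂ a₃)ᶜ ∩ openConn a₂ b) -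
        (prodBernoulli w).real ((openConn a₂ a₁)ᶜ ∩ (openConn a₂ a₃)ᶜ ∩ openConn a₃ b) := by
  have ht := knThm2_tau_sub w b a₂ a₁ a₃
  have e1 : ((openConn a₂ a₃)ᶜ ∩ (openConn a₁ a₃)ᶜ ∩ (openConn a₂ b ∩ openConn a₁ b) : Set (BondConfig (Fin n))) =
      (openConn a₁ a₃)ᶜ ∩ (openConn a₂ a₃)ᶜ ∩ (openConn a₁ b ∩ openConn a₂ b) := by
    rw [Set.inter_comm ((openConn a₂ a₃)ᶜ) ((openConn a₁ a₃)ᶜ), Set.inter_comm (openConn a₂ b) (openConn a₁ b)]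
  have e2 : ((openConn a₂ a₃)ᶜ ∩ (openConn a₁ a₃)ᶜ ∩ openConn a₃ b : Set (BondConfig (Fin n))) =
      (openConn a₁ a₃)ᶜ ∩ (openConn a₂ a₃)ᶜ ∩ openConn a₃ b := by
    rw [Set.inter_comm ((openConn a₂ a₃)ᶜ) ((openConn a₁ a₃)ᶜ)]
  rw [e1, e2] at ht
  have h3 := obs_m3_split w b a₁ a₂ a₃
  have h4 := obs_t3N2_split w b a₁ a₂ a₃
  linarith

/-! ### The clean form: `L₁({o↔a₁}) = (T₁₂ − U₁₂) + I₂ + (T₁ − U₁)` -/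

/-- Part of `{a₁↔o} ∩ {a₁↔b}` off `{a₁↔a₃}` and on `{a₁↔a₂}`: the term `T₁₂`. [folklore] -/
theorem obs_setA1 (o b a₁ a₂ a₃ : Fin n) :
    (((openConn a₁ o ∩ openConn a₁ b) \ openConn a₁ a₃) ∩ openConn a₁ a₂ : Set (BondConfig (Fin n))) =
      (openConn a₁ a₃)ᶜ ∩ (openConn a₂ a₃)ᶜ ∩ ((openConn a₁ o ∪ openConn a₂ o) ∩ (openConn a₁ b ∩ openConn a₂ b)) := by
  ext ω
  simp only [Set.mem_sdiff, Set.mem_inter_iff, Set.mem_union, Set.mem_compl_iff, knThm2_mem_openConn]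
  constructor
  · rintro ⟨⟨⟨h1o, h1b⟩, h13⟩, h12⟩
    exact ⟨⟨h13, fun h => h13 (h12.trans h)⟩, Or.inl h1o, h1b, h12.symm.trans h1b⟩
  · rintro ⟨⟨h13, -⟩, hO, h1b, h2b⟩
    have h12 : (openGraph ω).Reachable a₁ a₂ := h1b.trans h2b.symm
    refine ⟨⟨⟨?_, h1b⟩, h13⟩, h12⟩
    rcases hO with h | h
    · exact h
    · exact h12.trans h

/-- Part of `{a₁↔o} ∩ {a₁↔b}` off `{a₁↔a₃}` and off `{a₁↔a₂}`: the term `T₁`. [folklore] -/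
theorem obs_setA2 (o b a₁ a₂ a₃ : Fin n) :
    (((openConn a₁ o ∩ openConn a₁ b) \ openConn a₁ a₃) \ openConn a₁ a₂ : Set (BondConfig (Fin n))) =
      (openConn a₁ a₂)ᶜ ∩ (openConn a₁ a₃)ᶜ ∩ (openConn a₁ o ∩ openConn a₁ b) := by
  ext ω
  simp only [Set.mem_sdiff, Set.mem_inter_iff, Set.mem_compl_iff]
  tauto

/-- On `{a₁↔a₃}`, `{a₁↔o} ∩ {a₃↔b} = {a₁↔o} ∩ {a₁↔b}`. [folklore] -/
theorem obs_setB0 (o b a₁ a₃ : Fin n) :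
    ((openConn a₁ o ∩ openConn a₃ b) ∩ openConn a₁ a₃ : Set (BondConfig (Fin n))) =
      (openConn a₁ o ∩ openConn a₁ b) ∩ openConn a₁ a₃ := by
  ext ω
  simp only [Set.mem_inter_iff, knThm2_mem_openConn]
  constructor
  · rintro ⟨⟨h1o, h3b⟩, h13⟩
    exact ⟨⟨h1o, h13.trans h3b⟩, h13⟩
  · rintro ⟨⟨h1o, h1b⟩, h13⟩
    exact ⟨⟨h1o, h13.symm.trans h1b⟩, h13⟩

/-- Part of `{a₁↔o} ∩ {a₃↔b}` off `{a₁↔a₃}` and on `{a₁↔a₂}` (the glued-world term `U₁₂^{W}`). [folklore] -/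
theorem obs_setB1 (o b a₁ a₂ a₃ : Fin n) :
    (((openConn a₁ o ∩ openConn a₃ b) \ openConn a₁ a₃) ∩ openConn a₁ a₂ : Set (BondConfig (Fin n))) =
      (openConn a₁ a₃)ᶜ ∩ (openConn a₁ a₂ ∩ (openConn a₁ o ∩ openConn a₃ b)) := by
  ext ω
  simp only [Set.mem_sdiff, Set.mem_inter_iff, Set.mem_compl_iff]
  tauto

/-- Part of `{a₁↔o} ∩ {a₃↔b}` off `{a₁↔a₃}` and off `{a₁↔a₂}`: `V₁ := μ(N₁ ∩ {a₁↔o} ∩ {a₃↔b})`. [folklore] -/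
theorem obs_setB2 (o b a₁ a₂ a₃ : Fin n) :
    (((openConn a₁ o ∩ openConn a₃ b) \ openConn a₁ a₃) \ openConn a₁ a₂ : Set (BondConfig (Fin n))) =
      (openConn a₁ a₂)ᶜ ∩ (openConn a₁ a₃)ᶜ ∩ (openConn a₁ o ∩ openConn a₃ b) := by
  ext ω
  simp only [Set.mem_sdiff, Set.mem_inter_iff, Set.mem_compl_iff]
  tauto

/-- On `N₁ ∩ {a₃↔b}`, `a₂ ↔ a₃` iff `a₂ ↔ b`: the part `U₁` of `V₁`. [folklore] -/
theorem obs_setB3 (o b a₁ a₂ a₃ : Fin n) :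
    ((openConn a₁ a₂)ᶜ ∩ (openConn a₁ a₃)ᶜ ∩ (openConn a₁ o ∩ openConn a₃ b) ∩ openConn a₂ a₃ : Set (BondConfig (Fin n))) =
      (openConn a₁ a₂)ᶜ ∩ (openConn a₁ a₃)ᶜ ∩ (openConn a₁ o ∩ (openConn a₂ b ∩ openConn a₃ b)) := by
  ext ω
  simp only [Set.mem_inter_iff, Set.mem_compl_iff, knThm2_mem_openConn]
  constructor
  · rintro ⟨⟨hN, h1o, h3b⟩, h23⟩
    exact ⟨hN, h1o, h23.trans h3b, h3b⟩
  · rintro ⟨hN, h1o, h2b, h3b⟩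
    exact ⟨⟨hN, h1o, h3b⟩, h2b.trans h3b.symm⟩

/-- The part `I₁ := μ(M ∩ {a₁↔o} ∩ {a₃↔b})` of `V₁`. [folklore] -/
theorem obs_setB4 (o b a₁ a₂ a₃ : Fin n) :
    (((openConn a₁ a₂)ᶜ ∩ (openConn a₁ a₃)ᶜ ∩ (openConn a₁ o ∩ openConn a₃ b)) \ openConn a₂ a₃ : Set (BondConfig (Fin n))) =
      (openConn a₁ a₂)ᶜ ∩ (openConn a₁ a₃)ᶜ ∩ (openConn a₂ a₃)ᶜ ∩ (openConn a₁ o ∩ openConn a₃ b) := by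
  ext ω
  simp only [Set.mem_sdiff, Set.mem_inter_iff, Set.mem_compl_iff]
  tauto

/-- Part of `U₁₂`'s event on `{a₁↔a₂}` (the glued-world term `U₁₂^{W}`, same set as in `obs_setB1`). [folklore] -/
theorem obs_setC1 (o b a₁ a₂ a₃ : Fin n) :
    ((openConn a₁ a₃)ᶜ ∩ (openConn a₂ a₃)ᶜ ∩ ((openConn a₁ o ∪ openConn a₂ o) ∩ openConn a₃ b) ∩ openConn a₁ a₂ : Set (BondConfig (Fin n))) =
      (openConn a₁ a₃)ᶜ ∩ (openConn a₁ a₂ ∩ (openConn a₁ o ∩ openConn a₃ b)) := by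
  ext ω
  simp only [Set.mem_inter_iff, Set.mem_union, Set.mem_compl_iff, knThm2_mem_openConn]
  constructor
  · rintro ⟨⟨⟨h13, -⟩, hO, h3b⟩, h12⟩
    refine ⟨h13, h12, ?_, h3b⟩
    rcases hO with h | h
    · exact h
    · exact h12.trans h
  · rintro ⟨h13, h12, h1o, h3b⟩
    exact ⟨⟨⟨h13, fun h => h13 (h12.trans h)⟩, Or.inl h1o, h3b⟩, h12⟩

/-- Part of `U₁₂`'s event off `{a₁↔a₂}`: the all-separated part. [folklore] -/
theorem obs_setC2 (o b a₁ a₂ a₃ : Fin n) :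
    (((openConn a₁ a₃)ᶜ ∩ (openConn a₂ a₃)ᶜ ∩ ((openConn a₁ o ∪ openConn a₂ o) ∩ openConn a₃ b)) \ openConn a₁ a₂ : Set (BondConfig (Fin n))) =
      (openConn a₁ a₂)ᶜ ∩ (openConn a₁ a₃)ᶜ ∩ (openConn a₂ a₃)ᶜ ∩ ((openConn a₁ o ∪ openConn a₂ o) ∩ openConn a₃ b) := by
  ext ω
  simp only [Set.mem_sdiff, Set.mem_inter_iff, Set.mem_compl_iff]
  tauto

/-- The all-separated part of `U₁₂` with `o ↔ a₁`: the set of `obs_setB4` (`I₁`). [folklore] -/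
theorem obs_setC3 (o b a₁ a₂ a₃ : Fin n) :
    ((openConn a₁ a₂)ᶜ ∩ (openConn a₁ a₃)ᶜ ∩ (openConn a₂ a₃)ᶜ ∩ ((openConn a₁ o ∪ openConn a₂ o) ∩ openConn a₃ b) ∩ openConn a₁ o : Set (BondConfig (Fin n))) =
      (openConn a₁ a₂)ᶜ ∩ (openConn a₁ a₃)ᶜ ∩ (openConn a₂ a₃)ᶜ ∩ (openConn a₁ o ∩ openConn a₃ b) := by
  ext ω
  simp only [Set.mem_inter_iff, Set.mem_union, Set.mem_compl_iff]
  tauto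

/-- The all-separated part of `U₁₂` with `o ↮ a₁` (hence `o ↔ a₂`): `I₂ := μ(M ∩ {a₂↔o} ∩ {a₃↔b})`. [folklore] -/
theorem obs_setC4 (o b a₁ a₂ a₃ : Fin n) :
    (((openConn a₁ a₂)ᶜ ∩ (openConn a₁ a₃)ᶜ ∩ (openConn a₂ a₃)ᶜ ∩ ((openConn a₁ o ∪ openConn a₂ o) ∩ openConn a₃ b)) \ openConn a₁ o : Set (BondConfig (Fin n))) =
      (openConn a₂ a₁)ᶜ ∩ (openConn a₂ a₃)ᶜ ∩ (openConn a₁ a₃)ᶜ ∩ (openConn a₂ o ∩ openConn a₃ b) := by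
  ext ω
  simp only [Set.mem_sdiff, Set.mem_inter_iff, Set.mem_union, Set.mem_compl_iff, knThm2_mem_openConn]
  constructor
  · rintro ⟨⟨⟨⟨h12, h13⟩, h23⟩, hO, h3b⟩, h1o⟩
    rcases hO with h | h
    · exact absurd h h1o
    · exact ⟨⟨⟨fun h' => h12 h'.symm, h23⟩, h13⟩, h, h3b⟩
  · rintro ⟨⟨⟨h21, h23⟩, h13⟩, h2o, h3b⟩
    exact ⟨⟨⟨⟨fun h => h21 h.symm, h13⟩, h23⟩, Or.inr h2o, h3b⟩, fun h1o => h21 (h2o.trans h1o.symm)⟩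

/-- **`L₁({o↔a₁})` on the Theorem-2 split terms:**
`μ(o↔a₁, a₁↔b) − μ(o↔a₁, a₃↔b) = (T₁₂ − U₁₂) + I₂ + (T₁ − U₁)` with `I₂ = μ(M ∩ {a₂↔o} ∩ {a₃↔b})`
(partition by `{a₁↔a₃}`, `{a₁↔a₂}`, `{a₂↔a₃}`, `{a₁↔o}`; the `{a₁↔a₃}`-parts cancel). [folklore] -/
theorem obs_L1_split (w : Sym2 (Fin n) → unitInterval) (o b a₁ a₂ a₃ : Fin n) :
    (prodBernoulli w).real (openConn a₁ o ∩ openConn a₁ b) - (prodBernoulli w).real (openConn a₁ o ∩ openConn a₃ b) =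
      ((prodBernoulli w).real ((openConn a₁ a₃)ᶜ ∩ (openConn a₂ a₃)ᶜ ∩ ((openConn a₁ o ∪ openConn a₂ o) ∩ (openConn a₁ b ∩ openConn a₂ b))) -
          (prodBernoulli w).real ((openConn a₁ a₃)ᶜ ∩ (openConn a₂ a₃)ᶜ ∩ ((openConn a₁ o ∪ openConn a₂ o) ∩ openConn a₃ b))) +
        (prodBernoulli w).real ((openConn a₂ a₁)ᶜ ∩ (openConn a₂ a₃)ᶜ ∩ (openConn a₁ a₃)ᶜ ∩ (openConn a₂ o ∩ openConn a₃ b)) +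
        ((prodBernoulli w).real ((openConn a₁ a₂)ᶜ ∩ (openConn a₁ a₃)ᶜ ∩ (openConn a₁ o ∩ openConn a₁ b)) -
          (prodBernoulli w).real ((openConn a₁ a₂)ᶜ ∩ (openConn a₁ a₃)ᶜ ∩ (openConn a₁ o ∩ (openConn a₂ b ∩ openConn a₃ b)))) := by
  have hm : ∀ s : Set (BondConfig (Fin n)), MeasurableSet s := fun _ => MeasurableSet.of_discrete
  have ha := measureReal_inter_add_sdiff (μ := prodBernoulli w) (s := (openConn a₁ o ∩ openConn a₁ b : Set (BondConfig (Fin n))))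
    (hm (openConn a₁ a₃))
  have ha' := measureReal_inter_add_sdiff (μ := prodBernoulli w)
    (s := ((openConn a₁ o ∩ openConn a₁ b) \ openConn a₁ a₃ : Set (BondConfig (Fin n)))) (hm (openConn a₁ a₂))
  rw [obs_setA1, obs_setA2] at ha'
  have hb := measureReal_inter_add_sdiff (μ := prodBernoulli w) (s := (openConn a₁ o ∩ openConn a₃ b : Set (BondConfig (Fin n))))
    (hm (openConn a₁ a₃))
  rw [obs_setB0] at hb
  have hb' := measureReal_inter_add_sdiff (μ := prodBernoulli w)
    (s := ((openConn a₁ o ∩ openConn a₃ b) \ openConn a₁ a₃ : Set (BondConfig (Fin n)))) (hm (openConn a₁ a₂))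
  rw [obs_setB1, obs_setB2] at hb'
  have hb'' := measureReal_inter_add_sdiff (μ := prodBernoulli w)
    (s := ((openConn a₁ a₂)ᶜ ∩ (openConn a₁ a₃)ᶜ ∩ (openConn a₁ o ∩ openConn a₃ b) : Set (BondConfig (Fin n))))
    (hm (openConn a₂ a₃))
  rw [obs_setB3, obs_setB4] at hb''
  have hc := measureReal_inter_add_sdiff (μ := prodBernoulli w)
    (s := ((openConn a₁ a₃)ᶜ ∩ (openConn a₂ a₃)ᶜ ∩ ((openConn a₁ o ∪ openConn a₂ o) ∩ openConn a₃ b) : Set (BondConfig (Fin n))))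
    (hm (openConn a₁ a₂))
  rw [obs_setC1, obs_setC2] at hc
  have hc' := measureReal_inter_add_sdiff (μ := prodBernoulli w)
    (s := ((openConn a₁ a₂)ᶜ ∩ (openConn a₁ a₃)ᶜ ∩ (openConn a₂ a₃)ᶜ ∩ ((openConn a₁ o ∪ openConn a₂ o) ∩ openConn a₃ b) : Set (BondConfig (Fin n))))
    (hm (openConn a₁ o))
  rw [obs_setC3, obs_setC4] at hc'
  linarith

end

end Summit.CriticalPhenomena.PercolationContinuityZ3.Theorems
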